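import Literature.MathematicalPhysics.QuantumFieldTheory.Balaban1983to89.B8Eq140PureGaugePotential
import Literature.MathematicalPhysics.QuantumFieldTheory.Balaban1983to89.B8Prop7BoxFormWitness
import Literature.MathematicalPhysics.QuantumFieldTheory.Balaban1983to89.B8Prop7TowerAxialUnitary
import Literature.MathematicalPhysics.QuantumFieldTheory.Balaban1983to89.B8SockB9P3ShellModeVacuityUniv
import Literature.MathematicalPhysics.QuantumFieldTheory.Balaban1983to89.B8Prop7PrintedRTowerAxialRecordP

/-!
# `Balaban1983to89.B8Prop7PrintedRZdGF3BoxFormInterTower` — [Balaban1985RegularSpaces] Proposition 7 AS TYPED-PRINTED (`B8SectGH.Prop7PrintedR`,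
# constant `2α₂` in (1.145)) is FALSE ALSO IN THE BOX FORM of NODE 00's carrier `zdGF3` (R453 (B)'s «(1.66)₁ box form»: both `j`-blocks in `Ω_j`)
# with print's PINNED tower-wise map `toAxialTower`, at an INTERIOR INTER-TOWER BOND of print's own nested cube family `(T, □₁, □₂)` —
# `d = 4`, `𝔸 = ℂ`, EVERY `L ≥ 9`; hence the box-form `p7` doors of the K1 record knits (`famB8OfRecordSubB` ∕ `SubBH` ∕ `famB8OfRecord`) are
# false at the family dictionary `stage3OfFamily F` with the honest pin, exactly as the P-carrier ones

statement-level skeleton of published theorems with citation tags; proofs where landed; nothing here is a claim about the Yang–Mills mass gap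

T. Bałaban, *Spaces of regular gauge field configurations on a lattice and gauge fixing conditions*, Commun. Math. Phys. **99** (1985) 75–102
`[Balaban1985RegularSpaces]` ("B8"; journal page = PDF page + 74): Prop. 7 (1.143)–(1.145) p. 100 («|(U′U₀‾)ʲ − Ū₀ʲ| = |exp iQ_j(U₀, ηA) − 1| < 2α₂
on Ω_j^{(j)}»), (1.139)–(1.140) p. 100, (1.35) p. 82, (1.66) p. 88, (1.3)–(1.6) p. 77, (1.131) p. 99 (the cube family), p. 77 (bond convention).
[3] = T. Bałaban, *Averaging operations for lattice gauge theories*, Commun. Math. Phys. **98** (1985) 17–51 `[Balaban1985Averaging]`: (76)–(77)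
pp. 29–30, (81) p. 30, (85) p. 31, (87) p. 31, (88) p. 31.

## WHY THIS FILE (cell `pub-ymgap`, HUMAN RULING D-0062 ∕ D-0149 ∕ D-0154; N05 = [B8]; width seat `pub-ymgap-dag-n05-w5` g3, CLAIM-2 of
## 2026-08-28T08:07Z — g2's HANDOFF located «the box-form printed Proposition 7 with the pinned map is neither refuted nor proved at constant 2»)

The lineage's P₇-currency certificates (r05 `B8Ineq145Lineage`; n05-w2 `B8Prop7PrintedRZdGF3P2HalfSpace`; this seat g0∕g2 `…AllL`, `…CStar`,
`B8Prop7PrintedRTowerAxialRecordP`) refute the printed constant `2α₂` for print's pinned map on the ONE-END-POINT carriers `zdGF3P₂∕HP₂` at a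
`∂Λ₁`-CROSSING bond (G-B8-01: gauge fixing of depth 1 on one side, `u = 1` on the other).  NODE 00's carrier OF RECORD `famB8OfRecord := zdGF3`
(R453 (B)) reads (1.145) in BOX FORM — both `j`-blocks of the bond inside `Ω_j` — which excludes those bonds, and g2's evidence note left the
box form open.  THIS FILE closes it NEGATIVELY for `L ≥ 9` with a NEW witness and a NEW mechanism:
* the member is print's nested cube family `(T, □₁, □₂)` of (1.131) at `k = 2` (`cubeFam true L 0 1 L 2`, lawful `IdxB8LawsB`, admissible
  `DomainSeq`, `Ω₀ = ℤ⁴` — n05-c's `exists_topCube_member_lawsB`), the bond is the level-`0` bond `⟨x, x + e₀⟩` from the top corner site `x` of the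
  corner 2-block `T = B²(w)`, `w = (L,L,L,L)`, of `□₂` into the adjacent depth-1 top `T′ = B¹(z′) ⊂ □₁ ∖ □₂` — its box lies in `Ω₀`, in fact in `Ω₁`;
* the configuration is a PURE GAUGE `U₁ = e^{iηA}`, `A = −dψ∕η` (so the third member of (1.140) vanishes identically and the first two are lattice
  differences of `ψ`, `B8Eq140PureGaugePotential`), `U₀ = 1`;
* [3]'s gauge fixing normalises EACH tower by its own frame average ((81)∕(87)), so print's tower-wise map of depth 2 on `T` and depth 1 on `T′` turns
  `U₁` into the CONSTANT transition function `e^{i(M₂ψ(w) − M₁ψ(z′))}` on every bond from `T` to `T′` (`B7GaugeFixingPureGauge.mgauge_interTower_pureGauge`):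
  print's identity «`|(U′U₀‾)ʲ − Ū₀ʲ| = |exp iQ_j − 1|`» is exact between two tops of the same `Λ_j` ((88)∕(92)) but NOT across depths, where the
  difference of the two tower MEANS of the potential appears;
* for the potential `ψ = κ₀(Σ_i y_i + q(y₀ − N))` of `B8Prop7BoxFormWitness` (`κ₀ = 0.9999·α₂∕L²`: print's maximal slope on `□₂`, where (1.140) at
  `j = 2` pins `|Δψ| < α₂∕L²`, `|ΔΔψ| < α₂∕L⁴`; quadratic bend across `T′`, where only `j ≤ 1` applies: `|ΔΔψ| < α₂∕L²`) one gets
  `M₁ψ(z′) − M₂ψ(w) = κ₀(2L² − L) + κ₀(L−1)(L−2)∕6 = κ₀(13L² − 9L + 2)∕6`, which exceeds `2α₂` iff `L² − 9L + 2 > 0` iff `L ≥ 9`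
  (ratio `974∕972` at `L = 9`); the typed box-form (1.145) at level `0` on that bond says `2|sin(Φ∕2)| ≤ 2α₂` — absurd for `α₂ ≤ 1∕32`.

## WHAT IS PROVED (kernel, 0 sorry; theorems only)

* §3 ★★ `not_prop7PrintedR_zdGF3_toAxialTower_boxForm (L) (hL9 : 9 ≤ L) (hL1 : 1 ≤ L) (β) (len)`: `∃ i : ZdIdx 4 L`, `i.k = 2`, `IdxB8LawsB L i`,
  `DomainSeq L i.Ω`, `i.Ω 0 = univ`, `i.Ω = cubeFam true L 0 1 L 2`, with `¬ B8SectGH.Prop7PrintedR (fun _ : Unit => zdGF3 ℂ L β len i) (fun _ =>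
  toAxialTower ℂ L β len hL1 i)` (the private `final_arith` is the sine arithmetic); ★ `exists_member_repairedC_not_printedR_boxForm` (at the same
  member the REPAIRED `Prop7RepairedC (530·4)` holds — n05-c's theorem by name — while the printed one fails).
* §4 — MOVED by the EDITION of 2026-08-29 (director-ym №260, FLAG №14 T0 (γ)) to the leaf `B8Prop7PrintedRZdGF3BoxFormInterTowerFamily` with RE-KEY-NEUTRAL proofs off the
  C⋆-generic twin `B8Prop7PrintedRZdGF3BoxFormInterTowerCStar` §2 (same short names and statements); formerly here at the family dictionary `θ₀ := stage3OfFamily F`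
  (`D = 4`, `𝔸 = ℂ`, `L = F.L ≥ 13`, `rfl`): ★ `exists_idxB8SubB_not_prop7PrintedR_boxForm_stage3OfFamily`;
  ★★ `not_prop7PrintedR_famB8OfRecordSubB_toAxialTowerResid_stage3OfFamily` (the SubB knits' `p7` binder with the map pinned is false);
  ★★ `not_prop7PrintedR_famB8OfRecord_toAxialTowerResid_stage3OfFamily` (the WHOLE family of record with the candidate pin `toAxialTowerResid` of
  `ResidB8.toAxial`); ★★ `not_prop7PrintedR_famB8OfRecordSubBH_toAxialTowerResid_stage3OfFamily` (the repaired-carrier twin `zdGF3H`, `rfl` fields).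

## HONEST SCOPE ∕ LIMITS

A NEGATIVE certificate about a proof CURRENCY (the typed-printed constant `2α₂` of (1.145), box form, pinned map) — NO estimate of
[Balaban1985RegularSpaces] is proved anew or denied; the REPAIRED currency HOLDS on the same data (n05-c's `B8Prop7TowerAxialRecord.prop7RepairedC_famB8OfRecordSubB`,
constant `530·D`, box form, pinned map) and is untouched: constants only, nothing downstream of [B8] is affected.  `L ≥ 9` ONLY: for `L ∈ {3, 5, 7}` the
pure-gauge witnesses do NOT exceed `2α₂` (their supremum is `α₂(2 − 1∕L + (L−1)(L−2)∕(6L²))`, pointwise optimal under (1.140) given the interface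
pinning at `∂T`); curved witnesses are LOCATED, not typed; `stage3OfRecord₁₂` (`L = 3`) is therefore NOT covered, the family dictionary (`L = F.L ≥ 13`)
is.  `𝔸 = ℂ` (the faces at a general `θ.𝔸` would go through central units as in `B8Ineq145LineageCStar` — not done here).  Count-neutral helper keyed `stmt-QuantumFields-26907` (K1⁸ `StabilityBRunRowsAtRecordR13SepCoPH`, route rev 27; successor of the aside K1⁷ 20542); N05 NOT discharged; no summit statement is proved by this seat — R4 closes the
conditional finite-`𝕋⁴` rung `BalabanLadder.UV` only; nothing continuum ∕ ℝ⁴ ∕ OS ∕ mass-gap ∕ Clay.  No `sorry`, no `def`, no `instance`, no `notation`.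
Unit `pub-ymgap-dag-n05-w5` (g3), 2026-08-28.

RELATED IN THE TREE, NOT DUPLICATED: `B7GaugeFixingPureGauge` (this seat: the pure-gauge calculus of [3]'s gauge fixing, USED), `B8Eq140PureGaugePotential`
(this seat: (1.140) for pure gauges, USED), `B8Prop7BoxFormWitness` (this seat: the potential's arithmetic, USED), `B8SockB9P3ShellModeVacuityUniv`
(n05-c: the lawful top-cube member, USED), `B8Prop7TowerAxialZd3` ∕ `…Unitary` (n05-c: the pinned map and its unitary regime, USED),
`B8Prop7TowerAxialRecord` (n05-c: `toAxialTowerResid`, `prop7RepairedC_famB8OfRecordSubB(H)` — the positive repaired currency), `B8Prop7PrintedRTowerAxialRecordP`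
∕ `…CStar` ∕ `…AllL` (this lineage: the P-carrier faces; the present file is their box-form counterpart), `B8LeafKnit.prop7PrintedR_precomp` (restriction, USED).

[cite: Balaban1985RegularSpaces, Prop. 7 (1.143)–(1.145) p.100, (1.139)–(1.140) p.100, (1.35) p.82, (1.66) p.88, (1.3)–(1.6) p.77, (1.131) p.99, p.77;
Balaban1985Averaging, (76)–(77) pp.29–30, (81) p.30, (85) p.31, (87) p.31, (88) p.31]
-/

noncomputable section

open NormedSpace Finset

namespace Literature.MathematicalPhysics.QuantumFieldTheory.Balaban1983to89.B8Prop7PrintedRZdGF3BoxFormInterTower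

open Complex (I)
open B7Prop1Explicit B7Prop1Local B7Prop2Explicit B7Eq92Concrete B7Eq84Concrete B7AvgGaugeCovariance
open B8Ineq130 (tlo thi tlo_apply thi_apply fl)
open B8Ineq132 (Under InAk covDerivFwd PlaqTouches)
open B8Eq140Level (SideTouches IsSide)
open B8Eq143PlaqExpansion (pdiv)
open B8Eq146AExpansion (plaqCovDeriv plaqCovDeriv_eq_covDerivFwd)
open B8Eq184Proof (cfgExp)
open B8Lemma1NonAbelian (mulCfg)
open B8Thm4Concrete (mulCfg_eq_mul)
open B8IdxB8LawsB (IdxB8LawsB IdxB8SubB famB8OfRecordSubB)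
open B8ConstraintBonds (DomainSeq)
open B8LeafModelZd (ZdIdx)
open B8LeafModelZd3 (zdGF3 mlogCfg mlogCfg_spec)
open B8Prop7AdmittedFamily (cst cst_pos)
open B8Prop7TowerAxialZd3 (uTower toAxialTower toAxialTower_of_unitary uTower_of_maximal InTower)
open B8Prop7TowerAxialUnitary (uTower_facts)
open B8Eq115GaugeFixing (fl_block)
open B8Eq131Cubes (cube sqLo sqHi bLo bHi gs gs_zero gs_succ)
open B8Eq131CubesAdmissible (cubeFam cubeFam_true_zero cubeFam_of_pos cubeFam_domainSeq)
open B8SockB9P3ShellModeVacuityUniv (exists_topCube_member_lawsB)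
open B8Eq106Local (under_iff_tower)
open B8Eq131Derivation (under_zero_iff under_one_block under_succ_of_under_block)
open B8Ineq145 (stairMean stairMean_eq)
open B8Ineq145Lineage (eI hyp139)
open B9SupplySockB9P3ZdSocketBoundaryMode (cfgExp_mem_unitaryUnits)
open B7GaugeFixingPureGauge (norm_mgauge_interTower_sub_one cfgExp_potential_eq_gaugeAct sum_inv_card_box)
open B8Eq140PureGaugePotential (sideTouches_coord_le c140_zdGF3_potential)
open B8Prop7BoxFormWitness (potential_bounds potential_values block_means smallness)

-- `Site` alone could resolve to the torus sites of `Setup.lean`; re-export the `ℤ^d` sites of `B7Prop1Explicit`.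
export B7Prop1Explicit (Site)

/-! ## §3 The certificate: the box-form (1.145) at constant `2` FAILS on the inter-tower bond of the cube member, `d = 4`, every `L ≥ 9` -/

section Certificate

/-- The arithmetic of the witness (private plumbing): with `κ₀L² = 0.9999·α₂`, `α₂ ≤ 1∕32`, `L ≥ 9`, the phase `X = κ₀(13L² − 9L + 2)∕12` satisfies
`X ≥ 1.0019·α₂` (since `(L − 9)(79L − 18) ≥ 0`) and `X ≤ 1∕25`, so `sin X > X − X³∕4 > α₂`: the box-form (1.145) bound `2|sin(−X)| ≤ 2α₂` is absurd.
[cite: Balaban1985RegularSpaces, Prop. 7 (1.145) p.100 (bookkeeping: the arithmetic of the located failure)] -/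
private theorem final_arith {L α₂ κ₀ : ℝ} (hL : 9 ≤ L) (h0 : 0 < α₂) (h32 : α₂ ≤ 1 / 32) (hκ₀ : 0 < κ₀)
    (hκ₀L2 : κ₀ * L ^ 2 = 9999 / 10000 * α₂)
    (hle : 2 * |Real.sin ((κ₀ * (L * (L * (4 * L) + 2 * (L - 1)) + 2 * (L - 1))
      - κ₀ * (L * (4 * L ^ 2 + 4 * L - 3) + 2 * (L - 1) + (L ^ 4)⁻¹ * (L ^ 3 * (L * (L - 1) * (L - 2) / 6)))) / 2)| ≤ 2 * α₂) :
    False := by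
  have hLpos : (0 : ℝ) < L := by linarith
  have hL0 : L ≠ 0 := hLpos.ne'
  set X : ℝ := κ₀ * (13 * L ^ 2 - 9 * L + 2) / 12 with hXdef
  have hΦ : (κ₀ * (L * (L * (4 * L) + 2 * (L - 1)) + 2 * (L - 1))
      - κ₀ * (L * (4 * L ^ 2 + 4 * L - 3) + 2 * (L - 1) + (L ^ 4)⁻¹ * (L ^ 3 * (L * (L - 1) * (L - 2) / 6)))) / 2 = -X := by
    rw [hXdef]; field_simp; ring
  have hρ : 487 * 12 * L ^ 2 ≤ 486 * (13 * L ^ 2 - 9 * L + 2) := by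
    nlinarith [mul_nonneg (sub_nonneg.mpr hL) (show (0:ℝ) ≤ 79 * L - 18 by linarith)]
  have hX12 : 12 * X * L ^ 2 = 9999 / 10000 * α₂ * (13 * L ^ 2 - 9 * L + 2) := by
    rw [hXdef, ← hκ₀L2]; field_simp
  have hL2pos : (0 : ℝ) < L ^ 2 := by positivity
  have hXlo : 10019 / 10000 * α₂ ≤ X := by nlinarith
  have hXhi : X ≤ 1 / 25 := by nlinarith
  have hX0 : 0 < X := by linarith
  have hXπ : X < Real.pi := by linarith [Real.pi_gt_three]
  rw [hΦ, Real.sin_neg, abs_neg, abs_of_pos (Real.sin_pos_of_pos_of_lt_pi hX0 hXπ)] at hle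
  have hs := Real.sin_gt_sub_cube hX0
  have hX2 : X ^ 2 ≤ 1 / 625 := by nlinarith
  have hX3 : X ^ 3 / 6 ≤ X / 3750 := by
    have : X ^ 3 = X * X ^ 2 := by ring
    rw [this]; nlinarith
  nlinarith

/-- ★★ **[Balaban1985RegularSpaces] PROPOSITION 7 AS TYPED-PRINTED (`B8SectGH.Prop7PrintedR`, constant `2α₂` in (1.145)) IS FALSE IN THE BOX FORM OF
NODE 00's CARRIER `zdGF3` WITH PRINT'S PINNED TOWER-WISE MAP, AT AN INTERIOR INTER-TOWER BOND, `d = 4`, `𝔸 = ℂ`, EVERY `L ≥ 9`.**  The member is print's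
own nested cube family `(T, □₁, □₂)` (`cubeFam true L 0 1 L 2`: `Ω₀ = ℤ⁴`, `□₂^{(2)} = [−L, L]⁴`, `□₁^{(1)} = [−L(L+1), L²+2L−1]⁴`, collar `L` level-1
blocks; `k = 2`, `η = L⁻²`), LAWFUL (`IdxB8LawsB`) and ADMISSIBLE (`DomainSeq`).  For every threshold `c > 0` take `α₀ = α₂ = min{c, 1∕32, c(4,L)}`,
`U₀ = 1` ((1.33) trivially), and the PURE GAUGE `U₁ = e^{iηA}`, `A = −dψ∕η`, with the potential `ψ(y) = κ₀(Σ_i y_i + q(y₀ − N))`, `κ₀ = 0.9999·α₂∕L²`,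
`N = L³ + L²` the first fine coordinate beyond the top corner 2-block `T = B²(w)`, `w = (L,L,L,L)`, of `□₂` in direction `0`, `q` the profile of
`profile_diff` (zero on `T`, bending quadratically across the adjacent depth-1 top `T′ = B¹(z′)`): it obeys ALL THREE members of (1.140) on every `Ω_j`
(`c140_zdGF3_potential`: on `□₂`-touching bonds `Δψ ≡ κ₀`, `ΔΔψ ≡ 0`; elsewhere `|Δψ| ≤ κ₀L`, `|ΔΔψ| ≤ κ₀`), the map is in its unitary regime
(`uTower_facts`), and on the level-`0` bond `⟨x, x + e₀⟩` from the top corner site `x` of `T` into `T′` — box trivially in `Ω₀` — the carrier's box-form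
(1.145) reads `‖(U₁^{uTower}·U₀)(x,0) − U₀(x,0)‖ ≤ 2α₂`, whereas by `B7GaugeFixingPureGauge.norm_mgauge_interTower_sub_one` (depth 2 on `T`, depth 1 on `T′`,
`uTower_of_maximal`) the left member is `2|sin((M₂ψ(w) − M₁ψ(z′))∕2)|` with `M₁ψ(z′) − M₂ψ(w) = κ₀(2L² − L) + κ₀(L−1)(L−2)∕6 = κ₀(13L² − 9L + 2)∕6`,
which exceeds `2α₂` exactly when `L² − 9L + 2 > 0`, i.e. for `L ≥ 9` (at `L = 9` the ratio is `974∕972`).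
[cite: Balaban1985RegularSpaces, Prop. 7 (1.143)–(1.145) p.100, (1.139)–(1.140) p.100, (1.35) p.82, (1.66) p.88, (1.3)–(1.6) p.77, (1.131) p.99; Balaban1985Averaging, (76)–(77) pp.29–30, (81) p.30, (87) p.31, (88) p.31] -/
theorem not_prop7PrintedR_zdGF3_toAxialTower_boxForm (L : ℕ) (hL9 : 9 ≤ L) (hL1 : 1 ≤ L) (β : ℝ) (len : Site 4 → ℝ) :
    ∃ i : ZdIdx 4 L, i.k = 2 ∧ IdxB8LawsB L i ∧ DomainSeq L i.Ω ∧ i.Ω 0 = Set.univ ∧ i.Ω = cubeFam true L 0 1 L 2 ∧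
      ¬ B8SectGH.Prop7PrintedR (fun _ : Unit => zdGF3 ℂ L β len i) (fun _ => toAxialTower ℂ L β len hL1 i) := by
  have hL2 : 2 ≤ L := by omega
  have hLr : (9 : ℝ) ≤ L := by exact_mod_cast hL9
  have hLpos : (0 : ℝ) < L := by linarith
  have hL0 : (L : ℝ) ≠ 0 := hLpos.ne'
  -- the member: print's family `(T, □₁, □₂)` at `k = 2`, `η = L⁻²`
  have hη : (0 : ℝ) < ((L : ℝ) ^ 2)⁻¹ := by positivity
  have hscale : (L : ℝ) ^ 2 * ((L : ℝ) ^ 2)⁻¹ ≤ 1 := by rw [mul_inv_cancel₀ (pow_ne_zero 2 hL0)]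
  obtain ⟨i, hik, hiη, hΩ, -, -, -, hlaws⟩ :=
    exists_topCube_member_lawsB (d := 4) hL1 (0 : Site 4) 1 (le_refl L) (k := 2) (by norm_num) hη hscale
  have hds : DomainSeq L i.Ω := by rw [hΩ]; exact cubeFam_domainSeq true hL1 (0 : Site 4) 1 (le_refl L) 2
  have hΩ0 : i.Ω 0 = Set.univ := by rw [hΩ]; exact cubeFam_true_zero L 0 1 L 2
  have hΩ1 : i.Ω 1 = cube L (0 : Site 4) 1 L 2 1 := by rw [hΩ]; exact cubeFam_of_pos true L 0 1 L le_rfl one_le_two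
  have hΩ2 : i.Ω 2 = cube L (0 : Site 4) 1 L 2 2 := by rw [hΩ]; exact cubeFam_of_pos true L 0 1 L one_le_two le_rfl
  refine ⟨i, hik, hlaws, hds, hΩ0, hΩ, ?_⟩
  rintro ⟨c, hc, H⟩
  -- the smallness parameters
  set α₂ : ℝ := min c (min (1 / 32) (cst 4 L)) with hα₂
  have hcst : 0 < cst 4 L := cst_pos (by norm_num) L hL1
  have h0 : 0 < α₂ := lt_min hc (lt_min (by norm_num) hcst)
  have hc2 : α₂ ≤ c := min_le_left _ _
  have h32 : α₂ ≤ 1 / 32 := (min_le_right _ _).trans (min_le_left _ _)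
  have hcs : α₂ ≤ cst 4 L := (min_le_right _ _).trans (min_le_right _ _)
  have h16 : 16 * α₂ ≤ 1 := by linarith
  set κ₀ : ℝ := 9999 / 10000 * α₂ / (L : ℝ) ^ 2 with hκ₀
  have hκ₀pos : 0 < κ₀ := by positivity
  have hκ₀L2 : κ₀ * (L : ℝ) ^ 2 = 9999 / 10000 * α₂ := by rw [hκ₀]; field_simp
  have hκ₀L2lt : κ₀ * (L : ℝ) ^ 2 < α₂ := by rw [hκ₀L2]; linarith
  have hL1r : (1 : ℝ) ≤ L := by exact_mod_cast hL1
  have hκ₀L : κ₀ * L < α₂ := lt_of_le_of_lt (by nlinarith) hκ₀L2lt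
  -- the corners of `□₂`, `□₁`
  have hsqHi2 : ∀ j : Fin 4, sqHi L (0 : Site 4) 1 L 2 2 j = (L : ℤ) := fun j => by
    simp [sqHi, bHi, gs_zero]
  have hsqLo2 : ∀ j : Fin 4, sqLo L (0 : Site 4) L 2 2 j = -(L : ℤ) := fun j => by
    simp [sqLo, bLo, gs_zero]
  have hgs1 : gs L 1 = L + 1 := by rw [gs_succ, gs_zero, mul_one]
  have hsqHi1 : ∀ j : Fin 4, sqHi L (0 : Site 4) 1 L 2 1 j = (L : ℤ) - 1 + L * (L + 1) := fun j => by
    simp [sqHi, bHi, hgs1]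
  have hsqLo1 : ∀ j : Fin 4, sqLo L (0 : Site 4) L 2 1 j = -((L : ℤ) * (L + 1)) := fun j => by
    simp [sqLo, bLo, hgs1]
  have hmem2 : ∀ y : Site 4, y ∈ i.Ω 2 ↔ ∀ j, -((L : ℤ) ^ 2 * L) ≤ y j ∧ y j ≤ (L : ℤ) ^ 2 * (L + 1) - 1 := by
    intro y
    rw [hΩ2]
    show InBox _ _ y ↔ _
    simp only [InBox, tlo_apply, thi_apply, hsqLo2, hsqHi2, mul_neg]
  have hmem1 : ∀ y : Site 4, y ∈ i.Ω 1 ↔ ∀ j, (L : ℤ) * -((L : ℤ) * (L + 1)) ≤ y j ∧ y j ≤ (L : ℤ) * ((L : ℤ) - 1 + L * (L + 1) + 1) - 1 := by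
    intro y
    rw [hΩ1]
    show InBox _ _ y ↔ _
    simp only [InBox, tlo_apply, thi_apply, hsqLo1, hsqHi1, pow_one]
  -- the towers `T = B²(w)` and `T′ = B¹(z′)`, the bond `⟨x, x + e₀⟩`
  set w : Site 4 := fun _ => (L : ℤ) with hwdef
  set rt : Fin 4 → Fin L := fun _ => ⟨L - 1, by omega⟩ with hrtdef
  set zz : Site 4 := (L : ℤ) • w + boxVec L rt with hzzdef
  set x : Site 4 := (L : ℤ) • zz + boxVec L rt with hxdef
  set z' : Site 4 := zz + e 0 with hz'def
  set r' : Fin 4 → Fin L := fun j => if j = 0 then ⟨0, by omega⟩ else ⟨L - 1, by omega⟩ with hr'def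
  have hrt : ∀ j, boxVec L rt j = (L : ℤ) - 1 := fun j => by simp [boxVec, hrtdef, Nat.cast_sub hL1]
  have hw : ∀ j, w j = L := fun _ => rfl
  have hzz : ∀ j, zz j = L * L + (L - 1) := fun j => by
    rw [hzzdef, Pi.add_apply, Pi.smul_apply, smul_eq_mul, hrt]
  have hx : ∀ j, x j = L * (L * L + (L - 1)) + (L - 1) := fun j => by
    rw [hxdef, Pi.add_apply, Pi.smul_apply, smul_eq_mul, hrt, hzz]
  have hz'0 : z' 0 = L * L + L := by rw [hz'def, Pi.add_apply, hzz, e_apply, if_pos rfl]; ring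
  have hz'j : ∀ j, j ≠ 0 → z' j = L * L + (L - 1) := fun j hj => by rw [hz'def, Pi.add_apply, hzz, e_apply, if_neg hj, add_zero]
  have hx' : x + e 0 = (L : ℤ) • z' + boxVec L r' := by
    funext j
    by_cases hj : j = 0
    · subst hj
      rw [Pi.add_apply, hx, e_apply, if_pos rfl, Pi.add_apply, Pi.smul_apply, smul_eq_mul, hz'0]
      simp [boxVec, hr'def]; ring
    · rw [Pi.add_apply, hx, e_apply, if_neg hj, Pi.add_apply, Pi.smul_apply, smul_eq_mul, hz'j j hj]
      simp [boxVec, hr'def, hj, Nat.cast_sub hL1]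
  have hx'0 : (x + e 0 : Site 4) 0 = L * (L * L + (L - 1)) + (L - 1) + 1 := by rw [Pi.add_apply, hx, e_apply, if_pos rfl]
  have hflx : fl L x = zz := fl_block hL1 zz rt
  have hflzz : fl L zz = w := fl_block hL1 w rt
  have hflx' : fl L (x + e 0) = z' := by rw [hx']; exact fl_block hL1 z' r'
  have hUwx : Under L 2 w x := under_succ_of_under_block (under_one_block L w rt) (under_one_block L zz rt)
  have hUz'x' : Under L 1 z' (x + e 0) := by rw [hx']; exact under_one_block L z' r'
  -- `T ⊂ □₂`, `T′ ⊂ □₁`, `x + e₀ ∉ □₂`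
  have hTsub : ∀ y, InBox (tlo L w 2) (thi L w 2) y → y ∈ i.Ω 2 := by
    intro y hy
    rw [hmem2]
    intro j
    obtain ⟨h1, h2⟩ := hy j
    rw [tlo_apply] at h1
    rw [thi_apply] at h2
    change (L : ℤ) ^ 2 * (L : ℤ) ≤ y j at h1
    change y j ≤ (L : ℤ) ^ 2 * ((L : ℤ) + 1) - 1 at h2
    constructor <;> nlinarith
  have hT'sub : ∀ y, InBox (tlo L z' 1) (thi L z' 1) y → y ∈ i.Ω 1 := by
    intro y hy
    rw [hmem1]
    intro j
    obtain ⟨h1, h2⟩ := hy j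
    rw [tlo_apply, pow_one] at h1
    rw [thi_apply, pow_one] at h2
    have hzb : L * L + (L - 1) ≤ z' j ∧ z' j ≤ L * L + L := by
      by_cases hj : j = 0
      · subst hj; rw [hz'0]; constructor <;> linarith
      · rw [hz'j j hj]; constructor <;> linarith
    constructor <;> nlinarith [hzb.1, hzb.2]
  have hx'not2 : x + e 0 ∉ i.Ω 2 := by
    rw [hmem2]
    intro h
    have := (h 0).2
    rw [hx'0] at this
    nlinarith
  -- tower memberships through the cover law №11
  have hwtop : w ∈ i.Λs i.k i.k := by
    obtain ⟨j, hj1, hj2, y, hy, hU⟩ := hlaws.toIdxB8Laws.cover i.k le_rfl w (by rw [hik]; exact hTsub)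
    have hjk : j = i.k := le_antisymm hj2 hj1
    subst hjk
    rw [Nat.sub_self, under_zero_iff] at hU
    rw [hU]; exact hy
  have hz'top : z' ∈ i.Λs i.k 1 := by
    obtain ⟨j, hj1, hj2, y, hy, hU⟩ := hlaws.toIdxB8Laws.cover 1 (by rw [hik]; norm_num) z' hT'sub
    rw [hik] at hj2
    rcases eq_or_lt_of_le hj1 with hj | hj
    · subst hj
      rw [Nat.sub_self, under_zero_iff] at hU
      rw [hU]; exact hy
    · exfalso
      have hj2' : j = 2 := by omega
      subst hj2'
      -- `z′` would lie one level under a top of `□₂^{(2)}`, so `x + e₀ ∈ □₂`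
      have hU2 : Under L 2 y (x + e 0) := under_succ_of_under_block hU hUz'x'
      have hIB : InBox (tlo L y 2) (thi L y 2) (x + e 0) := fun i' =>
        ⟨((under_iff_tower L 2 y (x + e 0)).1 hU2).1 i', ((under_iff_tower L 2 y (x + e 0)).1 hU2).2 i'⟩
      exact hx'not2 (i.htower 2 (by rw [hik]) y hy (x + e 0) hIB)
  have hx'max : ∀ J, 1 < J → J ≤ i.k → ¬ InTower L (i.Λs i.k) J (x + e 0) := by
    intro J hJ1 hJ2 ⟨y, hy, hU⟩
    rw [hik] at hJ2
    have hJ : J = 2 := by omega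
    subst hJ
    have hIB : InBox (tlo L y 2) (thi L y 2) (x + e 0) := fun i' =>
      ⟨((under_iff_tower L 2 y (x + e 0)).1 hU).1 i', ((under_iff_tower L 2 y (x + e 0)).1 hU).2 i'⟩
    exact hx'not2 (i.htower 2 (by rw [hik]) y hy (x + e 0) hIB)
  -- the witness potential `ψ = κ₀(Σ_i y_i + q(y₀ − N))`
  set N : ℤ := (x + e 0 : Site 4) 0 with hNdef
  have hN : N = L * (L * L + (L - 1)) + (L - 1) + 1 := hx'0
  set q : ℤ → ℝ := fun t => (if t ≤ 1 then (0 : ℝ) else if t ≤ (L : ℤ) then ((t : ℤ) : ℝ) * (((t : ℤ) : ℝ) - 1) / 2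
        else (L : ℝ) * ((L : ℝ) - 1) / 2 + ((L : ℝ) - 1) * (((t : ℤ) : ℝ) - L)) with hqdef
  set ψ : Site 4 → ℝ := fun y => κ₀ * ((∑ j, ((y j : ℤ) : ℝ)) + q (y 0 - N)) with hψdef
  obtain ⟨hΔbd, hΔin, hΔΔbd, hΔΔin⟩ := potential_bounds L hL2 N hκ₀pos q (fun _ => rfl) ψ (fun _ => rfl)
  -- where `□₂`-touching bonds sit: left of `N`
  have htouch2 : ∀ (y : Site 4) (τ : Fin 4), SideTouches (i.Ω 2) y τ → y 0 - N ≤ -1 ∨ τ ≠ 0 := by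
    intro y τ hst
    by_cases hτ : τ = 0
    · subst hτ
      left
      have hS : ∀ c ∈ i.Ω 2, c 0 ≤ (L : ℤ) ^ 2 * (L + 1) - 1 := fun c hc => ((hmem2 c).1 hc 0).2
      have := sideTouches_coord_le hS hst
      rw [hN]; nlinarith
    · exact Or.inr hτ
  have h1 : ∀ j, j ≤ i.k → ∀ (y : Site 4) (τ : Fin 4), SideTouches (i.Ω j) y τ → (L : ℝ) ^ j * |ψ (y + e τ) - ψ y| < α₂ := by
    intro j hj y τ hst
    rw [hik] at hj
    interval_cases j
    · rw [pow_zero, one_mul]; exact (hΔbd y τ).trans_lt hκ₀L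
    · rw [pow_one]
      calc (L : ℝ) * |ψ (y + e τ) - ψ y| ≤ L * (κ₀ * L) := mul_le_mul_of_nonneg_left (hΔbd y τ) hLpos.le
        _ = κ₀ * (L : ℝ) ^ 2 := by ring
        _ < α₂ := hκ₀L2lt
    · rw [hΔin y τ (htouch2 y τ hst), abs_of_pos hκ₀pos, mul_comm]; exact hκ₀L2lt
  have h2 : ∀ j, j ≤ i.k → ∀ (y : Site 4) (τ κ : Fin 4), SideTouches (i.Ω j) y τ →
      ((L : ℝ) ^ j) ^ 2 * |(ψ (y + e κ + e τ) - ψ (y + e κ)) - (ψ (y + e τ) - ψ y)| < α₂ := by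
    intro j hj y τ κ hst
    rw [hik] at hj
    have hj2 : ((L : ℝ) ^ j) ^ 2 * |(ψ (y + e κ + e τ) - ψ (y + e κ)) - (ψ (y + e τ) - ψ y)| ≤ ((L : ℝ) ^ j) ^ 2 * κ₀ :=
      mul_le_mul_of_nonneg_left (hΔΔbd y τ κ) (by positivity)
    interval_cases j
    · refine hj2.trans_lt ?_
      rw [pow_zero, one_pow, one_mul]
      exact lt_of_le_of_lt (le_mul_of_one_le_right hκ₀pos.le hL1r) hκ₀L
    · refine hj2.trans_lt ?_
      rw [pow_one, mul_comm]; exact hκ₀L2lt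
    · rw [hΔΔin y τ κ (htouch2 y τ hst), abs_zero, mul_zero]; exact h0
  -- (1.139), (1.140) for the pure gauge `U₁ = e^{iηA}`, `A = −dψ∕η`, at `U₀ = 1`
  have hall : ∀ (y : Site 4) (τ : Fin 4), SideTouches (i.Ω 0) y τ := fun y τ => by
    rw [hΩ0]
    by_cases hτ : τ = 0
    · subst hτ
      exact B8Eq140Level.sideTouches_of_bondTouches (κ := 1) (by decide) (Or.inl (Set.mem_univ _))
    · exact B8Eq140Level.sideTouches_of_bondTouches (κ := 0) (fun h => hτ h.symm) (Or.inl (Set.mem_univ _))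
  set A : Site 4 → Fin 4 → ℂ := fun z τ => ((((ψ z - ψ (z + e τ)) / i.η : ℝ)) : ℂ) with hAdef
  have hAh : ∀ (y : Site 4) (κ : Fin 4), IsSelfAdjoint (A y κ) := fun _ _ => Complex.conj_ofReal _
  have hAeq : cfgExp i.η A = gaugeAct (fun y => eI (ψ y)) 1 := cfgExp_potential_eq_gaugeAct i.hη.ne' ψ
  let U₀ : (zdGF3 ℂ L β len i).Cfg := ⟨1, fun _ _ => (unitaryUnits ℂ).one_mem⟩
  let U₁ : {U : Site 4 → Fin 4 → ℂˣ // ∀ y κ, U y κ ∈ unitaryUnits ℂ} := ⟨cfgExp i.η A, fun y κ => cfgExp_mem_unitaryUnits i.η hAh y κ⟩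
  let P : (zdGF3 ℂ L β len i).Pert := (U₀, U₁)
  have hInA : (zdGF3 ℂ L β len i).InA α₂ U₀ := by
    show InAk L i.k i.η α₂ i.Ω (1 : Site 4 → Fin 4 → ℂˣ)
    exact hyp139 L hL1 i.k i.hη h0 i.Ω
  have h140 : (zdGF3 ℂ L β len i).C140 α₂ U₀ P := c140_zdGF3_potential hL1 β len i hall ψ h0 h16 h1 h2 U₀ rfl P rfl
  -- print's map in its unitary regime
  have hunit := fun y => (uTower_facts (𝔸 := ℂ) (β := β) (len := len) (by norm_num : 2 ≤ 4) hL2 i hΩ0 h0 hcs h0 hcs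
    U₀ P hInA h140 y).1
  have hTA := toAxialTower_of_unitary (𝔸 := ℂ) (β := β) (len := len) hL1 i U₀ P hunit
  -- the box-form (1.145) at level `0` on the bond `⟨x, x + e₀⟩` (box trivially in `Ω₀ = ℤ⁴`)
  obtain ⟨-, havg⟩ := H () α₂ α₂ h0 hc2 h0 hc2 U₀ P hInA h140
  have hle := havg 0 (Nat.zero_le _) x 0 (fun y _ => by rw [hΩ0]; exact Set.mem_univ y)
  dsimp only at hle
  rw [hTA] at hle
  change ‖(((mulCfg (mgauge (1 : Site 4 → Fin 4 → ℂˣ) (uTower L hL1 i.k (i.Λs i.k) (1 : Site 4 → Fin 4 → ℂˣ) (cfgExp i.η A))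
      (cfgExp i.η A)) (1 : Site 4 → Fin 4 → ℂˣ)) x 0 : ℂˣ) : ℂ) - (((1 : Site 4 → Fin 4 → ℂˣ) x 0 : ℂˣ) : ℂ)‖ ≤ 2 * α₂ at hle
  rw [mulCfg_eq_mul, hAeq] at hle
  -- `uTower` is the depth-2 fixing on `T` and the depth-1 fixing on `T′`
  have hux : uTower L hL1 i.k (i.Λs i.k) (1 : Site 4 → Fin 4 → ℂˣ) (gaugeAct (fun y => eI (ψ y)) 1) x
      = glev L hL1 (1 : Site 4 → Fin 4 → ℂˣ) (gaugeAct (fun y => eI (ψ y)) 1) 2 0 x := by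
    rw [uTower_of_maximal (hL := hL1) (U₀ := (1 : Site 4 → Fin 4 → ℂˣ)) (U₁ := gaugeAct (fun y => eI (ψ y)) 1) le_rfl hwtop
      (by rw [hik]; exact hUwx) (fun J hJ hJk _ => absurd (lt_of_lt_of_le hJ hJk) (lt_irrefl _)), hik]
  have huxe : uTower L hL1 i.k (i.Λs i.k) (1 : Site 4 → Fin 4 → ℂˣ) (gaugeAct (fun y => eI (ψ y)) 1) (x + e 0)
      = glev L hL1 (1 : Site 4 → Fin 4 → ℂˣ) (gaugeAct (fun y => eI (ψ y)) 1) 1 0 (x + e 0) :=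
    uTower_of_maximal (hL := hL1) (U₀ := (1 : Site 4 → Fin 4 → ℂˣ)) (U₁ := gaugeAct (fun y => eI (ψ y)) 1)
      (by rw [hik]; norm_num) hz'top hUz'x' hx'max
  -- the block means of the potential, their values at `w` and `z′`, and the series-logarithm smallness
  set M₁ : Site 4 → ℝ := fun z => ∑ r : Fin 4 → Fin L, ((L : ℝ) ^ 4)⁻¹ * ψ ((L : ℤ) • z + boxVec L r) with hM₁def
  set M₂ : Site 4 → ℝ := fun v => ∑ s : Fin 4 → Fin L, ((L : ℝ) ^ 4)⁻¹ * M₁ ((L : ℤ) • v + boxVec L s) with hM₂def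
  obtain ⟨-, hM₁N, hM₂T⟩ := block_means L hL1 N κ₀ q (fun _ => rfl) ψ (fun _ => rfl) M₁ (fun _ => rfl) M₂ (fun _ => rfl)
  have hz'N : (L : ℤ) * z' 0 - N = 0 := by rw [hz'0, hN]; ring
  obtain ⟨hψ2, hM2, hψ1⟩ := smallness L hL9 N hκ₀pos h32 hκ₀L2 q (fun _ => rfl) ψ (fun _ => rfl) M₁ (fun _ => rfl) w hw hN z' hz'N
  have hblk : ∀ (s : Fin 4 → Fin L) (t : Fin L), (L : ℤ) * (((L : ℤ) • w + boxVec L s) 0) + ((t : ℕ) : ℤ) - N ≤ 1 := by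
    intro s t
    have hs : ((s 0 : ℕ) : ℤ) ≤ (L : ℤ) - 1 := by have := (s 0).isLt; omega
    have ht : ((t : ℕ) : ℤ) ≤ (L : ℤ) - 1 := by have := t.isLt; omega
    simp only [Pi.add_apply, Pi.smul_apply, smul_eq_mul, boxVec, hw]
    rw [hN]; nlinarith
  have hSw : (∑ j, ((w j : ℤ) : ℝ)) = 4 * L := by
    rw [Fin.sum_univ_four]
    change (((L : ℤ) : ℝ)) + ((L : ℤ) : ℝ) + ((L : ℤ) : ℝ) + ((L : ℤ) : ℝ) = 4 * (L : ℝ)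
    push_cast; ring
  have hSz' : (∑ j, ((z' j : ℤ) : ℝ)) = 4 * (L : ℝ) ^ 2 + 4 * L - 3 := by
    rw [Fin.sum_univ_four, hz'0, hz'j 1 (by decide), hz'j 2 (by decide), hz'j 3 (by decide)]
    push_cast; ring
  have hM₂w := hM₂T w hblk
  have hM₁z' := hM₁N z' (by linarith [hz'N])
  rw [hSw] at hM₂w
  rw [hSz'] at hM₁z'
  -- the left member of (1.145) on the bond, in closed form, and the arithmetic
  rw [norm_mgauge_interTower_sub_one L hL1 ψ M₁ M₂ (fun _ => rfl) (fun _ => rfl) _ x 0 hux huxe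
    (fun s r => by rw [hflx, hflzz]; exact hψ2 s r) (fun s => by rw [hflx, hflzz]; exact hM2 s)
    (fun r => by rw [hflx']; exact hψ1 r), hflx, hflzz, hflx', hM₂w, hM₁z'] at hle
  exact final_arith hLr h0 h32 hκ₀pos hκ₀L2 hle

/-- ★ **BOTH CURRENCIES AT THE SAME MEMBER, SAME PINNED MAP** (`d = 4`, `L ≥ 9`): on print's cube family `(T, □₁, □₂)` the REPAIRED box-form
Proposition 7 `B8Ineq145.Prop7RepairedC (530·4)` HOLDS for print's tower-wise map (n05-c's `B8Prop7TowerAxialIneq145.prop7RepairedC_zdGF3_toAxialTower`,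
BY NAME, from the member's laws №8) while the TYPED-PRINTED one (constant `2`) FAILS (`not_prop7PrintedR_zdGF3_toAxialTower_boxForm`) — the located
reading in one line: the weakening of N05's `p7` to the repaired currency is NECESSARY for the honest pin also on the box-form carrier of record, and
SUFFICIENT by n05-c. [cite: Balaban1985RegularSpaces, Prop. 7 (1.144)–(1.145) p.100 (constant: audit G-adv8-16 ∕ `B8Ineq145`), (1.66) p.88] -/
theorem exists_member_repairedC_not_printedR_boxForm (L : ℕ) (hL9 : 9 ≤ L) (hL1 : 1 ≤ L) (β : ℝ) (len : Site 4 → ℝ) :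
    ∃ i : ZdIdx 4 L, i.Ω = cubeFam true L 0 1 L 2 ∧
      B8Ineq145.Prop7RepairedC (530 * ((4 : ℕ) : ℝ)) (fun _ : Unit => zdGF3 ℂ L β len i) (fun _ => toAxialTower ℂ L β len hL1 i) ∧
      ¬ B8SectGH.Prop7PrintedR (fun _ : Unit => zdGF3 ℂ L β len i) (fun _ => toAxialTower ℂ L β len hL1 i) := by
  obtain ⟨i, -, hlaws, -, hΩ0, hΩ, hnot⟩ := not_prop7PrintedR_zdGF3_toAxialTower_boxForm L hL9 hL1 β len
  exact ⟨i, hΩ, B8Prop7TowerAxialIneq145.prop7RepairedC_zdGF3_toAxialTower ℂ L β len (by norm_num) (by omega : 2 ≤ L) (fun _ : Unit => i)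
    (fun _ => hΩ0) (fun _ => hlaws.toIdxB8Laws.trunc_lt) (fun _ => hlaws.toIdxB8Laws.trunc_top), hnot⟩

end Certificate

/-! ## §4 The record faces at the FAMILY DICTIONARY `stage3OfFamily F` — MOVED (EDITION director-ym №260, FLAG №14 T0 (γ), 2026-08-29)

The four family-dictionary faces formerly proved here (`exists_idxB8SubB_not_prop7PrintedR_boxForm_stage3OfFamily`,
`not_prop7PrintedR_famB8OfRecordSubB_toAxialTowerResid_stage3OfFamily`, `not_prop7PrintedR_famB8OfRecord_toAxialTowerResid_stage3OfFamily`,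
`not_prop7PrintedR_famB8OfRecordSubBH_toAxialTowerResid_stage3OfFamily`; 0 consumers in the tree) read §3's `ℂ`-certificate
`not_prop7PrintedR_zdGF3_toAxialTower_boxForm F.L …` through `(stage3OfFamily F).𝔸 = ℂ` by `rfl`, which the RECORD-NONABELIAN re-key
`stage3OfRecord₁₂.𝔸 := Matrix (Fin 2) (Fin 2) ℂ` (director-ym №256 (2)) removes.  They cannot be re-pointed to the C⋆-generic twin
`B8Prop7PrintedRZdGF3BoxFormInterTowerCStar` IN THIS FILE (that twin imports this file — an import cycle), so they now live, with the SAME short names and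
statements and RE-KEY-NEUTRAL proofs (the twin's `exists_idxB8SubB_not_prop7PrintedR_boxForm θ hD hL9 β len` ∕ `not_prop7PrintedR_famB8OfRecord…_toAxialTowerResid θ …`
at `θ := stage3OfFamily F`, any `θ.𝔸`), in the leaf `B8Prop7PrintedRZdGF3BoxFormInterTowerFamily` (namespace `…B8Prop7PrintedRZdGF3BoxFormInterTowerFamily`).
The generic negatives at EVERY record `θ` with `θ.D = 4`, `θ.L ≥ 9` are `B8Prop7PrintedRZdGF3BoxFormInterTowerCStar` §2.  §1–§3 of this file (the `ℂ`-model
certificate itself, member level) are UNTOUCHED. -/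

end Literature.MathematicalPhysics.QuantumFieldTheory.Balaban1983to89.B8Prop7PrintedRZdGF3BoxFormInterTower

end
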